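import Mathlib
import HarnessLib

/-!
# BiquadraticSecantLift — the cheapest falsifier `(d, δ, m) = (1, [3], 3)` machine-checked (J r1 F1; DOOR #3 §5.2)

HELPER FILE for crux X2 — the prover-landed copy (`Theorems/BiquadraticSecantLiftFalsifier133.lean`,
`--supports stmt-HodgeConjecture-22133`; namespace `…BiquadraticSecantLift.Falsifier133`, docstrings added, otherwise verbatim) of
the tribunal-w workfile `Cruxes/BiquadraticBaseChangeHyperbolic/Falsifier133.lean` (commit 1f7a48b5e223) for crux X2 `Theses.BiquadraticSecantLift.BiquadraticBaseChangeHyperbolic` (stmt-HodgeConjecture-22133) and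
X3 `BiquadraticWeilDescent` (22134) of route-HodgeConjecture-BiquadraticSecantLift (tribunal-w planner `hodge-biquad-w-1` g0,
2026-08-27). It decides ONE CELL of the hermitian-form arithmetic behind X2/X3 — pure linear algebra over `ℤ`/`ℚ`/`ℝ`, no
abelian variety occurs. It is NOT a witness for crux X1 (`MarkmanBiquadraticTwelvefolds`), NOT a case of the Hodge conjecture,
and proves nothing about rung H2 `WeilSixfolds`. The Hodge conjecture is NOT proved.

## Dictionary (DOOR #3 = pub-hsemireg step0/C `TWISTED-KUNNETH.md` §5.1–5.2, `DOOR3-THEOREMS-s0-3.md`; J r1 F1)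

* `K = ℚ(i)` (`d = 1`), `A` a `K`-Weil abelian sixfold whose `K`-hermitian form on `V = H¹(A, ℚ) ≅ K⁶` is
  `H = diag(1, 1, 1, -1, -1, -3)` (signature `(3,3)`, van Geemen invariant `δ = (-1)³·det H = 3 ∉ N(K^×)`: the NON-SPLIT
  class `[3] ≠ [1]` — `A` itself is not hyperbolic, so Markman 2025 Thm. 1.5.1 does not apply to it);
* `m = 3`, `B = A ⊞ A` with `ψ = ψ₃ : (x, y) ↦ (3y, x)` (`ψ² = 3`, real multiplication by `√3`), `L = K(√3) = ℚ(i, √3) = ℚ(ζ₁₂)`,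
  `F = L⁺ = ℚ(√3)`; `η = (φ ⊞ φ) ≫ (𝟙 + ψ)`, `η² = -(1 + ψ)² = -4 - 2ψ`, minimal polynomial `R_(1,3)(S) = S² + 8S + 4` of `η²`;
* in `K`-coordinates `V_B = V ⊕ V = K¹²` with basis `e₁…e₆` (first copy), `e₇…e₁₂ = √3·e₁ … √3·e₆` (second copy): the
  polarization `E_A ⊕ 3E_A` has `K`-hermitian Gram `½·Tr_{L/K}(H ⊗_K L) = H ⊕ 3H = gramK` (all entries rational, so on the
  rational span the hermitian form is the symmetric bilinear form with matrix `gramK`);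
* the `L`-subspace `W = span_L {e₁ + e₄, e₂ + e₅, √3·e₃ + e₆}` has `K`-basis the six rows of `lagK`.

## What is proved (0 sorry, axioms standard)

§1 `gramK`, its determinant `3⁸ ≠ 0`, signature `(3,3)` of `H` (hence `(3,3)` at BOTH real places of `F`, the entries being
rational); §2 `ψ² = 3`, `ψ` is `gramK`-self-adjoint (Rosati-invariant real multiplication); §3 `W` is TOTALLY ISOTROPIC
(`lagK * gramK * lagKᵀ = 0`), `ψ`-STABLE (`lagK * psiKᵀ = cK * lagK`) and of full rank `6 = ½·12` (an identity `6 × 6` minor) —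
i.e. an `η`-stable rational LAGRANGIAN: the `L`-hermitian form `H ⊗_K L` is split/hyperbolic, as predicted (J F1 (i)(ii),
DOOR #3 §5.2 (b)); §4 the discriminant arithmetic: `3` is a norm from `L` to `F` trivially (`√3·√3 = 3`, so
`disc(H ⊗ L) = -3 ≡ (-1)³`), while `3` is NOT a sum of two rational squares (`δ_A = [3] ≠ [1]` over `K = ℚ(i)`); §5 the
`inl^*` factor (J F1 (iii), DOOR #3 §5.2 (c)): the `σ`-eigenspace of `L` in `V_B ⊗ ℂ` over a fixed embedding of `K` is the graph
`{(±√3·y, y)}`, and `inl^* = pr₁` restricted to it is `y ↦ ±√3·y`, whose sixth exterior power = determinant is `(±√3)⁶ = 27 ≠ 0`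
— so `inl^*` maps each of the four `L`-Weil lines ONTO the `K`-Weil line below it; §6 the ring identity
`φ² = -d ∧ ψ² = m ∧ φψ = ψφ ⇒ R_(d,m)((φ(1+ψ))²) = 0` for all `(d, m)` (the route's `η_(d,m)` is annihilated by `R_(d,m)(T²)`),
and its `(1,3)` instance.

## References
[cite: vanGeemen1994HodgeAV, Lemma 5.2, 5.4–5.5] [cite: MoonenZarhin1998WeilClasses, §1] [cite: Landherr1936HermitianForms]
[cite: Markman2025SecantRealMultiplication, §1, §10.2 (preprint, unrefereed)] [cite: Deligne1982HodgeCycles, §4–5]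
-/

-- single-problem summit (Problem = Summit): the mandated namespace repeats `HodgeConjecture`.
set_option linter.dupNamespace false

namespace Summit.HodgeConjecture.HodgeConjecture.BiquadraticSecantLift.Falsifier133

open Matrix

/-! ## §1 The `K`-hermitian Gram matrix of `E_A ⊕ 3E_A` on `V_B = K¹²` -/

/-- The diagonal of `H = diag(1,1,1,-1,-1,-3)` (the `K = ℚ(i)`-hermitian form of `A`, `δ = [3]`). -/
def hDiag : Fin 6 → ℤ := ![1, 1, 1, -1, -1, -3]

/-- `gramK = H ⊕ 3H = ½·Tr_{L/K}(H ⊗_K L)` on the basis `e₁…e₆, √3e₁…√3e₆`. -/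
def gramDiag : Fin 12 → ℤ := ![1, 1, 1, -1, -1, -3, 3, 3, 3, -3, -3, -9]

/-- The Gram matrix `gramK = diag(1,1,1,-1,-1,-3,3,3,3,-3,-3,-9)`. -/
def gramK : Matrix (Fin 12) (Fin 12) ℤ := Matrix.diagonal gramDiag

/-- `det gramK = 3⁸` (the product of the diagonal `1,1,1,-1,-1,-3,3,3,3,-3,-3,-9`). -/
theorem gramK_det : gramK.det = 3 ^ 8 := by
  rw [gramK, Matrix.det_diagonal]
  decide

/-- `gramK` is non-degenerate. -/
theorem gramK_det_ne_zero : gramK.det ≠ 0 := by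
  rw [gramK_det]; norm_num

/-- Signature `(3,3)` of `H`: three positive and three negative diagonal entries (hence `(3,3)` at both real places of
`F = ℚ(√3)`, the entries being rational). -/
theorem hDiag_signature :
    (Finset.univ.filter fun i => 0 < hDiag i).card = 3 ∧ (Finset.univ.filter fun i => hDiag i < 0).card = 3 := by
  decide

/-- Signature `(6,6)` of `gramK = H ⊕ 3H`. -/
theorem gramDiag_signature :
    (Finset.univ.filter fun i => 0 < gramDiag i).card = 6 ∧ (Finset.univ.filter fun i => gramDiag i < 0).card = 6 := by
  decide

/-! ## §2 Real multiplication `ψ = √3` on `V_B`: `ψ(e_j) = e_{j+6}`, `ψ(e_{j+6}) = 3e_j` -/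

/-- `psiK` (acting on column vectors): `e_j ↦ e_{j+6}`, `e_{j+6} ↦ 3·e_j` (`j < 6`). -/
def psiK : Matrix (Fin 12) (Fin 12) ℤ :=
  Matrix.of fun i j => if (i : ℕ) = j + 6 then 1 else if (j : ℕ) = i + 6 then 3 else 0

/-- `ψ² = 3`. -/
theorem psiK_mul_psiK : psiK * psiK = (3 : ℤ) • (1 : Matrix (Fin 12) (Fin 12) ℤ) := by
  decide

/-- `ψ` is self-adjoint for `gramK` (Rosati-invariance of the real multiplication): `ψᵀ·G = G·ψ`. -/
theorem psiK_selfAdjoint : psiKᵀ * gramK = gramK * psiK := by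
  decide

/-! ## §3 The `η`-stable rational Lagrangian `W = span_L {e₁ + e₄, e₂ + e₅, √3e₃ + e₆}` -/

/-- `K`-basis of `W` (rows): `e₁+e₄, √3(e₁+e₄) = e₇+e₁₀, e₂+e₅, e₈+e₁₁, √3e₃+e₆ = e₉+e₆, √3(√3e₃+e₆) = 3e₃+e₁₂`. -/
def lagK : Matrix (Fin 6) (Fin 12) ℤ :=
  !![1, 0, 0, 1, 0, 0, 0, 0, 0, 0, 0, 0;
     0, 0, 0, 0, 0, 0, 1, 0, 0, 1, 0, 0;
     0, 1, 0, 0, 1, 0, 0, 0, 0, 0, 0, 0;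
     0, 0, 0, 0, 0, 0, 0, 1, 0, 0, 1, 0;
     0, 0, 0, 0, 0, 1, 0, 0, 1, 0, 0, 0;
     0, 0, 3, 0, 0, 0, 0, 0, 0, 0, 0, 1]

/-- **`W` is totally isotropic** for `gramK` (hence for the `L`-hermitian form `H ⊗_K L`, `W` being an `L`-subspace, and for
the polarization form `E_B = Tr(ξ·H_L)`). -/
theorem lagK_isotropic : lagK * gramK * lagKᵀ = 0 := by
  decide

/-- The matrix of `ψ` on the basis `lagK` of `W`: `ψ b₁ = b₂, ψ b₂ = 3b₁, …`. -/
def cK : Matrix (Fin 6) (Fin 6) ℤ :=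
  !![0, 1, 0, 0, 0, 0;
     3, 0, 0, 0, 0, 0;
     0, 0, 0, 1, 0, 0;
     0, 0, 3, 0, 0, 0;
     0, 0, 0, 0, 0, 1;
     0, 0, 0, 0, 3, 0]

/-- **`W` is `ψ`-stable** (row `i` of `lagK * psiKᵀ` is `ψ(bᵢ)`): so `W` is an `L = K(√3)`-subspace, in particular
`η = φ(1 + ψ)`-stable (`φ = i` acts by `K`-scalars). -/
theorem lagK_psi_stable : lagK * psiKᵀ = cK * lagK := by
  decide

/-- `cK² = 3`: `ψ|_W` is again multiplication by `√3`. -/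
theorem cK_mul_cK : cK * cK = (3 : ℤ) • (1 : Matrix (Fin 6) (Fin 6) ℤ) := by
  decide

/-- Column selection exhibiting an identity `6 × 6` minor of `lagK` (columns `e₁, e₇, e₂, e₈, e₆, e₁₂`). -/
def colSel : Fin 6 → Fin 12 := ![0, 6, 1, 7, 5, 11]

/-- **`W` has full rank `6 = ½ · dim_K V_B`**: `lagK` contains the identity as a `6 × 6` minor, so its six rows are linearly
independent over any field containing `ℚ` — `W` is a LAGRANGIAN (maximal isotropic: `dim = 6` in a `12`-dimensional
nondegenerate space). -/
theorem lagK_minor_eq_one : lagK.submatrix id colSel = 1 := by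
  decide

/-- The six rows of `lagK` are linearly independent over `ℤ` (read off the identity minor `colSel`). -/
theorem lagK_rows_linearIndependent : LinearIndependent ℤ (fun i => lagK i) := by
  rw [Fintype.linearIndependent_iff]
  intro g hg i
  have h := congr_fun hg (colSel i)
  simp only [Finset.sum_apply, Pi.smul_apply, smul_eq_mul, Pi.zero_apply] at h
  fin_cases i <;> simp [colSel, lagK, Fin.sum_univ_succ] at h <;> simpa using h

/-! ## §4 Discriminant arithmetic of the cell: split over `L/F`, non-split over `K/ℚ` -/

/-- `3 = √3 · √3` is a norm from `L = F(i)`… indeed already a square in `F = ℚ(√3)`: in `ℤ[√3]`, `√3 · √3 = 3`; hence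
`disc(H ⊗ L) = det H = -3 ≡ -1 = (-1)³` in `F^× / N_{L/F}(L^×)` (Deligne's condition (a) of hyperbolicity). -/
theorem sqrt3_mul_sqrt3 : (Zsqrtd.sqrtd : ℤ√3) * Zsqrtd.sqrtd = 3 := by
  decide

/-- `det H = 1·1·1·(-1)·(-1)·(-3) = -3`. -/
theorem det_hDiag : (Finset.univ.prod hDiag) = -3 := by
  decide

/-- **`3` is not a sum of two rational squares** (`3 ∉ N_{K/ℚ}(K^×)` for `K = ℚ(i)`): the van Geemen invariant of `A` is the
NON-SPLIT class `δ = [3] ≠ [1]`, so `A` is not hyperbolic over `K` and lies outside Markman's Thm. 1.5.1. Integer core: -/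
theorem three_mul_sq_ne_sq_add_sq (a b c : ℕ) (hc : 0 < c) : a ^ 2 + b ^ 2 ≠ 3 * c ^ 2 := by
  intro h
  have hsum : ∃ x y, 3 * c ^ 2 = x ^ 2 + y ^ 2 := ⟨a, b, h.symm⟩
  have h3 : (3 : ℕ) ∈ (3 * c ^ 2).primeFactors := by
    rw [Nat.mem_primeFactors]
    exact ⟨Nat.prime_three, dvd_mul_right 3 _, by positivity⟩
  have hev := (Nat.eq_sq_add_sq_iff.mp hsum) 3 h3 (by norm_num)
  haveI : Fact (Nat.Prime 3) := ⟨Nat.prime_three⟩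
  rw [padicValNat.mul (by norm_num) (by positivity), padicValNat.pow, padicValNat_self] at hev
  rcases hev with ⟨k, hk⟩
  omega

/-- `3` is not a sum of two rational squares: `3 ∉ N_{ℚ(i)/ℚ}(ℚ(i)^×)`, so the class `δ_A = [3]` is non-split. -/
theorem not_exists_rat_sq_add_sq_eq_three : ¬ ∃ x y : ℚ, x ^ 2 + y ^ 2 = 3 := by
  rintro ⟨x, y, h⟩
  -- clear denominators with `c = x.den * y.den`
  obtain ⟨a, ha⟩ : ∃ a : ℤ, x * (x.den * y.den : ℚ) = a :=
    ⟨x.num * y.den, by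
      have := Rat.mul_den_eq_num x
      push_cast
      calc x * ((x.den : ℚ) * y.den) = (x * x.den) * y.den := by ring
        _ = x.num * y.den := by rw [this]⟩
  obtain ⟨b, hb⟩ : ∃ b : ℤ, y * (x.den * y.den : ℚ) = b :=
    ⟨y.num * x.den, by
      have := Rat.mul_den_eq_num y
      push_cast
      calc y * ((x.den : ℚ) * y.den) = (y * y.den) * x.den := by ring
        _ = y.num * x.den := by rw [this]⟩
  have hc : 0 < x.den * y.den := Nat.mul_pos x.den_pos y.den_pos
  have key : (a : ℚ) ^ 2 + (b : ℚ) ^ 2 = 3 * ((x.den * y.den : ℕ) : ℚ) ^ 2 := by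
    rw [← ha, ← hb]; push_cast; linear_combination ((x.den : ℚ) * y.den) ^ 2 * h
  have key' : a.natAbs ^ 2 + b.natAbs ^ 2 = 3 * (x.den * y.den) ^ 2 := by
    have hz : (a.natAbs : ℤ) ^ 2 + (b.natAbs : ℤ) ^ 2 = 3 * ((x.den * y.den : ℕ) : ℤ) ^ 2 := by
      rw [Int.natAbs_sq, Int.natAbs_sq]; exact_mod_cast key
    exact_mod_cast hz
  exact three_mul_sq_ne_sq_add_sq _ _ _ hc key'

/-! ## §5 The `inl^*` factor `27` (J F1 (iii), DOOR #3 §5.2 (c)) -/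

/-- `pr₁` restricted to the graph `{(c·y, y)}` is multiplication by `c`. -/
theorem fst_comp_graph {V : Type*} [AddCommGroup V] [Module ℝ V] (c : ℝ) :
    (LinearMap.fst ℝ V V) ∘ₗ (LinearMap.prod (c • LinearMap.id) LinearMap.id) = c • LinearMap.id := by
  ext v; simp

/-- `(√3)⁶ = 27` and `(-√3)⁶ = 27`. -/
theorem sqrt_three_pow_six : (Real.sqrt 3) ^ 6 = 27 ∧ (-Real.sqrt 3) ^ 6 = 27 := by
  have h2 : (Real.sqrt 3) ^ 2 = 3 := Real.sq_sqrt (by norm_num)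
  have h6 : (Real.sqrt 3) ^ 6 = 27 := by
    calc (Real.sqrt 3) ^ 6 = ((Real.sqrt 3) ^ 2) ^ 3 := by ring
      _ = 27 := by rw [h2]; norm_num
  exact ⟨h6, by rw [neg_pow, h6]; norm_num⟩

/-- **The `inl^*` factor.** On a `6`-dimensional `σ|_K`-eigenspace `V_τ ≅ ℝ⁶` (real model), the composite
`V_τ → graph(±√3) → V_τ`, `y ↦ (±√3·y, y) ↦ ±√3·y`, has determinant (= action on `⋀⁶`, the Weil line) `(±√3)⁶ = 27 ≠ 0`:
`inl^*` maps the `L`-Weil line of each embedding `σ` onto the `K`-Weil line of `τ = σ|_K`. -/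
theorem det_inl_on_eigenGraph (ε : ℝ) (hε : ε = Real.sqrt 3 ∨ ε = -Real.sqrt 3) :
    LinearMap.det ((LinearMap.fst ℝ (Fin 6 → ℝ) (Fin 6 → ℝ)) ∘ₗ (LinearMap.prod (ε • LinearMap.id) LinearMap.id)) = 27 := by
  rw [fst_comp_graph, LinearMap.det_smul, LinearMap.det_id, mul_one, Module.finrank_fin_fun]
  rcases hε with h | h <;> rw [h]
  · exact sqrt_three_pow_six.1
  · exact sqrt_three_pow_six.2

/-! ## §6 `R_(d,m)` annihilates `η² = (φ(1+ψ))²` -/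

/-- For commuting `φ, ψ` with `φ² = -d`, `ψ² = m`: `η = φ(1 + ψ)` satisfies `R_(d,m)(η²) = 0`,
`R_(d,m)(S) = S² + 2d(1+m)S + d²(m-1)²` — the route's polynomial. (Stated in a commutative ring; in `End(A ⊞ A)` the
elements `φ ⊞ φ` and `ψ_m` commute and generate a commutative subring.) -/
theorem bqPoly_annihilates {R : Type*} [CommRing R] (d m : R) (φ ψ : R) (h1 : φ ^ 2 = -d) (h2 : ψ ^ 2 = m) :
    ((φ * (1 + ψ)) ^ 2) ^ 2 + 2 * d * (1 + m) * (φ * (1 + ψ)) ^ 2 + d ^ 2 * (m - 1) ^ 2 = 0 := by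
  linear_combination ((1 + ψ) ^ 4 * (φ ^ 2 - d) + 2 * d * (1 + m) * (1 + ψ) ^ 2) * h1 +
    d ^ 2 * (ψ ^ 2 + 4 * ψ + 4 - m) * h2

/-- The cell `(1, 3)`: `η² = -4 - 2ψ` and `R_(1,3)(S) = S² + 8S + 4` kills it. -/
theorem bqPoly_annihilates_one_three {R : Type*} [CommRing R] (φ ψ : R) (h1 : φ ^ 2 = -1) (h2 : ψ ^ 2 = 3) :
    (φ * (1 + ψ)) ^ 2 = -4 - 2 * ψ ∧ ((φ * (1 + ψ)) ^ 2) ^ 2 + 8 * (φ * (1 + ψ)) ^ 2 + 4 = 0 := by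
  constructor
  · linear_combination (1 + ψ) ^ 2 * h1 - h2
  · have := bqPoly_annihilates (1 : R) 3 φ ψ (by simpa using h1) h2
    linear_combination this

/-- Matrix form of the cell in `K`-coordinates: with `φ = i` a `K`-scalar, `η² = -(1 + ψ)²` and
`R_(1,3)(η²) = (1+ψ)⁴ - 8(1+ψ)² + 4 = 0` for `ψ = psiK`. -/
theorem psiK_cell :
    ((1 : Matrix (Fin 12) (Fin 12) ℤ) + psiK) ^ 4 - 8 • ((1 : Matrix (Fin 12) (Fin 12) ℤ) + psiK) ^ 2 + 4 • 1 = 0 := by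
  decide

end Summit.HodgeConjecture.HodgeConjecture.BiquadraticSecantLift.Falsifier133
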